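import Literature.AlgebraicGeometry.Resolution.PointBlowupIFPUnit
import HarnessLib

/-!
# Hauser–Perlega 2019, §3 Theorem: assertions (5), (8) and the `p^ℓ`-form of (9), typed

Source: H. Hauser, S. Perlega, *Characterizing the increase of the residual order under blowup in
positive characteristic*, Publ. RIMS 55 (2019) 835–857, §3 Theorem and its proof (pp. 11–12)
[`HauserPerlega2019PRIMS`].  The companion files already type assertion (4)
(`HauserPerlega2019.ObliqueOrderCondition` / `Condition4`), (6) (`ResidueInequality`), (7)
(`PowersOnlyOutside`) and (2) (`OrderMultipleCondition`).  This file adds, at STATEMENT level only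
(predicates; the printed implications "kangaroo point ⇒ (5), (8), (9)" are NOT asserted):

* `IsPthPowerLevel p e ℓ F` — "`ℓ < e` the largest integer so that `F` is a `p^ℓ`-th power"
  (over a perfect field: every exponent divisible by `p^ℓ`, not every exponent divisible by `p^{ℓ+1}`);
* `literalResidualDegree T F` — the theorem's `u = deg F − Σ_{i∈T} rᵢ` with the PRINTED
  `rᵢ = ord_{(xᵢ)} F` (the atlas' `residualDegree` uses the divisor multiplicities instead, which are `≤`);
* `NormalFormCongruence q j t u F` — assertion (5), in the equivalent congruence form obtained by
  multiplying the printed identity `G((1,x)+t) = ⌊∏(xᵢ+tᵢ)^{−rᵢ}·N^{p^e}⌋ᵤ` by the unit `∏(xᵢ+tᵢ)^{rᵢ}`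
  (invertible modulo `(x)^{u+1}`): the `u`-jet of `F((1,x)+t)` is a `p^e`-th power `N^{p^e}`;
* `LogHasseOrderCondition p ℓ j t T u F` — assertion (8) in the form the proof establishes,
  "`ord_{Q_T} Hᵢ = deg Hᵢ (= u)`" for the `p^ℓ`-th Hasse derivatives `∂_{xᵢ^{p^ℓ}} F`, `i ∈ T`
  (p. 12: "the assertion that `Hᵢ` is a polynomial in `(x_j − t_j x_1)^{p^ℓ}` and `x_k^{p^e}` … is
  equivalent to the equality `ord_{Q_T} Hᵢ = deg Hᵢ`"), typed with the tree's `hasseDeriv`,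
  `shear` and `orderAwayFrom`;
* `SharpJumpBound p ℓ e j b s` — the intermediate bound of the proof of (9), p. 12:
  "`ord I'₁ ≤ ord I + (c!/q)·p^ℓ ≤ ord I + c!/p`", i.e. for hypersurfaces `shade' ≤ shade + p^ℓ`,
  which refines `PointBlowup.MohBound` (`+ p^{e−1}`); `mohBound_of_sharpJumpBound` is the one-line
  comparison `p^ℓ ≤ p^{e−1}` for `ℓ < e`.

All polynomial statements are over `MvPolynomial σ K`, `K` a commutative ring, in the SHEARED
homogeneous coordinates used by `Condition4` (`shear j t P = P(y + t·y_j)`, the point moved onto the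
`y_j`-axis direction, `Q_T ↦ (yᵢ : i ≠ j)`, `ord_{Q_T} ↦ orderAwayFrom j`).
-/

namespace Literature.AlgebraicGeometry.Resolution

open MvPolynomial Finset
open scoped BigOperators
open Literature.AlgebraicGeometry.Resolution.Hauser2010

namespace HauserPerlega2019

variable {σ : Type*} {K : Type*} [CommRing K]

/-- "`ℓ < e` the largest integer so that `F` is a `p^ℓ`-th power" (the homogeneous `F` of assertion (3),
which is not a `p^e`-th power).  Over a perfect field a polynomial is a `p^ℓ`-th power iff every
exponent of every monomial is divisible by `p^ℓ`; we type that exponent condition together with its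
failure at `ℓ + 1`. [cite: HauserPerlega2019PRIMS, §3 Theorem (definition of ℓ before (5))] -/
def IsPthPowerLevel (p e ℓ : ℕ) (F : MvPolynomial σ K) : Prop :=
  ℓ < e ∧ (∀ d ∈ F.support, ∀ i, p ^ ℓ ∣ d i) ∧ ¬ (∀ d ∈ F.support, ∀ i, p ^ (ℓ + 1) ∣ d i)

/-- The number `b` of indices `i ∈ T` whose multiplicity `rᵢ` is not congruent to `0` modulo `p^{ℓ+1}`
("denote by `b` the number of exponents `rᵢ`, for `i ∈ T`, not congruent to `0` modulo `p^{ℓ+1}`").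
[cite: HauserPerlega2019PRIMS, §3 Theorem (definition of b before (5))] -/
def numNonMultiples (p ℓ : ℕ) (T : Finset σ) (r : σ → ℕ) : ℕ :=
  (T.filter fun i => ¬ p ^ (ℓ + 1) ∣ r i).card

/-- The theorem's `u = deg F − Σ_{i∈T} rᵢ` with the PRINTED multiplicities `rᵢ = ord_{(xᵢ)} F`
("Factorize `F` into `F(x) = x^r·G(x)` with `rᵢ = ord_{(xᵢ)} F`, for `i ∈ T`, and `G` a homogeneous
polynomial of degree `u = deg F − Σ_{i∈T} rᵢ`").  The atlas predicate `residualDegree` subtracts the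
exceptional multiplicities of the state instead (they divide `F`, so they are `≤ ord_{(xᵢ)} F` and the
atlas' `u` is `≥` this one). [cite: HauserPerlega2019PRIMS, §3 Theorem (4) (definition of u)] -/
noncomputable def literalResidualDegree (T : Finset σ) (F : MvPolynomial σ K) : ℕ :=
  F.totalDegree - ∑ i ∈ T, (PointBlowup.divisorOrder i F).toNat

/-- **Assertion (5), congruence form.**  Printed: "The polynomial `G(x)` of the factorization
`F(x) = x^r·G(x)` has, up to `p^e`-th powers, a unique form,
`G((1,x₂,…,xₙ)+t) = ⌊∏_{i∈T∖{1}} (xᵢ+tᵢ)^{−rᵢ} · N^{p^e}(x₂,…,xₙ)⌋ᵤ` for some polynomial `N(x₂,…,xₙ)`",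
`⌊−⌋ᵤ` the `u`-jet.  Multiplying by the unit `∏(xᵢ+tᵢ)^{rᵢ}` (invertible modulo `(x₂,…,xₙ)^{u+1}`) this
says: the `u`-jet of `F((1,x)+t) = ∏(xᵢ+tᵢ)^{rᵢ}·G((1,x)+t)` equals the `u`-jet of `N^{p^e}`.  Typed in
the sheared homogeneous coordinates of `Condition4` (chart variable `j` for the printed `x₁`): the
coefficient of `x^d` (`d_j = 0`, `|d| ≤ u`) in `F((1,x)+t)` is the coefficient of `x^d·x_j^{deg F − |d|}`
in `shear j t F`.  A PREDICATE ("(4) implies (5)" is the printed theorem, not asserted).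
[cite: HauserPerlega2019PRIMS, §3 Theorem (5)] -/
def NormalFormCongruence [DecidableEq σ] (q : ℕ) (j : σ) (t : σ → K) (u : ℕ) (F : MvPolynomial σ K) :
    Prop :=
  ∃ N : MvPolynomial σ K, (∀ d ∈ N.support, d j = 0) ∧
    ∀ d : σ →₀ ℕ, d j = 0 → d.degree ≤ u →
      coeff (d + Finsupp.single j (F.totalDegree - d.degree)) (shear j t F) = coeff d (N ^ q)

/-- **Assertion (8), order form.**  Printed: "For `i ∈ T`, the `p^ℓ`-th logarithmic Hasse derivatives
of `F(x)` with respect to `xᵢ` are of the form `xᵢ^{p^ℓ}·∂_{xᵢ^{p^ℓ}} F(x) = x^r·Hᵢ(x)`, where `Hᵢ` is a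
polynomial in `(x_j − t_j x₁)^{p^ℓ}` and `x_k^{p^e}`, for `j ∈ T∖{1}` and `k ∉ T`"; proof, p. 12: this
"is equivalent to the equality `ord_{Q_T} Hᵢ = deg Hᵢ`", and `deg Hᵢ = u`.  Since `ord_{Q_T} xᵢ = 0`
for `i ∈ T` (the lost components do not contain the line `Q_T`), `ord_{Q_T} ∂_{xᵢ^{p^ℓ}} F =
ord_{Q_T} Hᵢ ≤ u`, so (8) reads `ord_{Q_T} ∂_{xᵢ^{p^ℓ}} F ≥ u` for every `i ∈ T` (vacuous when the
derivative vanishes: order `⊤`).  Typed with `PointBlowup.hasseDeriv`, `Hauser2010.shear` (moving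
`Q_T` to `(x_k : k ≠ j)`) and `Hauser2010.orderAwayFrom`; `u` is the printed one
(`literalResidualDegree`).  A PREDICATE. [cite: HauserPerlega2019PRIMS, §3 Theorem (8) and its proof, p. 12] -/
def LogHasseOrderCondition [DecidableEq σ] (p ℓ : ℕ) (j : σ) (t : σ → K) (T : Finset σ) (u : ℕ)
    (F : MvPolynomial σ K) : Prop :=
  ∀ i ∈ T, (u : ℕ∞) ≤ orderAwayFrom j (shear j t (PointBlowup.hasseDeriv (Finsupp.single i (p ^ ℓ)) F))

/-- If a Hasse derivative in (8) vanishes, its clause holds (order `⊤`; the printed `Hᵢ = 0` is a polynomial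
in anything). [cite: HauserPerlega2019PRIMS, §3 Theorem (8) (degenerate case Hᵢ = 0)] -/
theorem logHasseOrderCondition_of_hasseDeriv_eq_zero [DecidableEq σ] (p ℓ : ℕ) (j : σ) (t : σ → K)
    (T : Finset σ) (u : ℕ) (F : MvPolynomial σ K)
    (h : ∀ i ∈ T, PointBlowup.hasseDeriv (Finsupp.single i (p ^ ℓ)) F = 0) :
    LogHasseOrderCondition p ℓ j t T u F := by
  intro i hi
  rw [h i hi]
  simp [shear, orderAwayFrom_zero]

/-- **The `p^ℓ`-form of assertion (9).**  Printed (9): "residual-order_{D'} J' ≤ residual-order_D J + c!/p";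
its proof (p. 12) passes through the sharper "`ord I'₁ ≤ ord I + (c!/q)·p^ℓ ≤ ord I + c!/p`" with `ℓ` the
`p`-th power level of the initial form.  For the hypersurface `x^{p^e} + F` (`c = q = p^e`, `c!/q = 1`,
residual order = shade) one step of the walk at the point `b` of the chart `y_j` therefore satisfies
`shade' ≤ shade + p^ℓ`.  A PREDICATE on the step (the atlas tests it row by row, cf. `PointBlowup.MohBound`
= the case `ℓ = e − 1`). [cite: HauserPerlega2019PRIMS, §3 Theorem (9), proof p. 12] -/
def SharpJumpBound [DecidableEq σ] [DecidableEq K] (p ℓ e : ℕ) (j : σ) (b : σ → K)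
    (s : PointBlowup.State σ K) : Prop :=
  (PointBlowup.step (p ^ e) j b s).shade ≤ s.shade + ((p ^ ℓ : ℕ) : ℕ∞)

/-- The `p^ℓ`-bound implies Moh's bound `shade' ≤ shade + p^{e−1}` since `p^ℓ ≤ p^{e−1}` for `ℓ < e` — the
printed last step "`≤ ord I + (c!/q)·p^ℓ ≤ ord I + c!/p`, which proves (9)".
[cite: HauserPerlega2019PRIMS, §3 Theorem (9), proof p. 12 (last inequality)] -/
theorem mohBound_of_sharpJumpBound [DecidableEq σ] [DecidableEq K] {p ℓ e : ℕ} (hp : 0 < p)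
    (hℓ : ℓ < e) {j : σ} {b : σ → K} {s : PointBlowup.State σ K} (h : SharpJumpBound p ℓ e j b s) :
    PointBlowup.MohBound p e j b s := by
  unfold SharpJumpBound at h
  unfold PointBlowup.MohBound
  refine le_trans h ?_
  have hle : p ^ ℓ ≤ p ^ (e - 1) := Nat.pow_le_pow_right hp (by omega)
  gcongr

/-- For `ℓ = e − 1` the `p^ℓ`-bound is literally Moh's bound ("Assertion (2) and the bound in (9) have been
known to Moh", comment (h)). [cite: HauserPerlega2019PRIMS, §3 Comments (h)] [cite: Moh1987, Stability Theorem] -/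
theorem sharpJumpBound_pred_iff_mohBound [DecidableEq σ] [DecidableEq K] (p e : ℕ) (j : σ) (b : σ → K)
    (s : PointBlowup.State σ K) : SharpJumpBound p (e - 1) e j b s ↔ PointBlowup.MohBound p e j b s :=
  Iff.rfl

end HauserPerlega2019

end Literature.AlgebraicGeometry.Resolution
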